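import Summits.AnomalousDissipation.AnomalousDissipation.Theorems.MomentLadder.Negative.Clauses
import Literature.Analysis.FunctionSpaces.TorusEnstrophyTrilinear
import Literature.Analysis.FunctionSpaces.TorusTruncationH1
import Literature.Analysis.FluidPDE.ZerothLaw

/-!
# Weighted palinstrophy bound: stub `stub_weightedPalinstrophyBound` of line `Sketch`
# (crux `MomentParity.MomentLadder`, stmt-AnomalousDissipation-11463)

The N-uniform WEIGHTED PALINSTROPHY BOUND of FMRT 2001 Ch. II App. B (B.9)–(B.11) at Galerkin
level: from the Stokes-weighted truncation row (A2b) and the weight-stationarity (A2c),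
`∫ ‖Δu‖²/(1+‖∇u‖²)² dμ ≤ C(f, ν, R)` uniformly in the level `N`, for every probability law carried
by level-`N` fields, supported in the ball of radius `R` and polynomially stationary at every degree.
Proof: the vortex-stretching term is absorbed by FMRT (A.26b)+Young
(`Torus.abs_integral_inner_convect_laplacian_le_dissipation`), the force term by Young, the weight
`(1+Z)⁻²` turns `Z³` into `Z`, and `ν ∫ Z dμ = ∫ (u,f) dμ ≤ ‖f‖₂ R` by the landed energy row.
-/

set_option linter.dupNamespace false

noncomputable section

namespace Summit.AnomalousDissipation.AnomalousDissipation.Theorems.MomentLadder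

open MeasureTheory Filter Topology Set
open scoped ENNReal NNReal InnerProductSpace RealInnerProductSpace Polynomial
open Literature.Analysis.FunctionSpaces Literature.Analysis.FluidPDE
open Summit.AnomalousDissipation.AnomalousDissipation.Theses.MomentParity
open Summit.AnomalousDissipation.AnomalousDissipation.Theorems.QuarticGate.Negative
open Summit.AnomalousDissipation.AnomalousDissipation.Theorems.MomentLadder.Negative

/-! ## Helpers: Young for the force term -/

/-- **Young / Cauchy–Schwarz for the force term**: for `L²` fields `f`, `w` and `a > 0`,
`|∫ ⟪f, w⟫| ≤ (2a)⁻¹ ∫‖f‖² + (a/2) ∫‖w‖²` (apply `|∫⟪f,w⟫| ≤ ½(∫‖f‖² + ∫‖w‖²)` to the pair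
`(a^{-1/2} f, a^{1/2} w)`). [folklore] -/
theorem abs_integral_inner_le_young {f w : UnitAddTorus (Fin 3) → EuclideanSpace ℝ (Fin 3)}
    (hf : MemLp f 2 volume) (hw : MemLp w 2 volume) {a : ℝ} (ha : 0 < a) :
    |∫ x, ⟪f x, w x⟫_ℝ| ≤ (2 * a)⁻¹ * (∫ x, ‖f x‖ ^ 2) + a / 2 * ∫ x, ‖w x‖ ^ 2 := by
  set s : ℝ := Real.sqrt a with hs
  have hs0 : 0 < s := Real.sqrt_pos.2 ha
  have hss : s * s = a := Real.mul_self_sqrt ha.le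
  have h := Torus.abs_integral_inner_le (hf.const_smul s⁻¹) (hw.const_smul s)
  have h1 : (fun x => ⟪(s⁻¹ • f) x, (s • w) x⟫_ℝ) = fun x => ⟪f x, w x⟫_ℝ := by
    funext x
    rw [Pi.smul_apply, Pi.smul_apply, real_inner_smul_left, real_inner_smul_right, ← mul_assoc,
      inv_mul_cancel₀ hs0.ne', one_mul]
  have h2 : (fun x => ‖(s⁻¹ • f) x‖ ^ 2) = fun x => a⁻¹ * ‖f x‖ ^ 2 := by
    funext x
    rw [Pi.smul_apply, norm_smul, mul_pow, Real.norm_eq_abs, abs_inv, abs_of_pos hs0, inv_pow,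
      sq, hss]
  have h3 : (fun x => ‖(s • w) x‖ ^ 2) = fun x => a * ‖w x‖ ^ 2 := by
    funext x
    rw [Pi.smul_apply, norm_smul, mul_pow, Real.norm_eq_abs, abs_of_pos hs0, sq, hss]
  simp only [h1, h2, h3, integral_const_mul] at h
  calc |∫ x, ⟪f x, w x⟫_ℝ| ≤ 2⁻¹ * (a⁻¹ * (∫ x, ‖f x‖ ^ 2) + a * ∫ x, ‖w x‖ ^ 2) := h
    _ = (2 * a)⁻¹ * (∫ x, ‖f x‖ ^ 2) + a / 2 * ∫ x, ‖w x‖ ^ 2 := by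
        rw [mul_inv]; ring

/-! ## Helpers: spectral versus classical `‖ΔP_N u‖²` and `‖∇P_N u‖²` on level-`N` fields -/

/-- The coefficients `k ↦ -4π²|k|² c k` of the Laplacian of a real trigonometric polynomial are
conjugate symmetric when `c` is. [folklore] -/
theorem isConjSymm_lapCoeff {c : (Fin 3 → ℤ) → EuclideanSpace ℂ (Fin 3)} (hc : Torus.IsConjSymm c) :
    Torus.IsConjSymm fun k => -(((4 * Real.pi ^ 2 * Torus.freqNormSq k : ℝ) : ℂ) • c k) := by
  -- adapted from `Literature.Analysis.FluidPDE.NSGalerkinEnstrophy2D.isConjSymm_laplacianCoeff`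
  intro k
  simp only [Torus.freqNormSq_neg, hc k]
  rw [EuclideanSpace.conjVec_neg, EuclideanSpace.conjVec_smul, Complex.conj_ofReal]

/-- `‖-4π²|k|² • c k‖² = 16π⁴ |k|⁴ ‖c k‖²`. [folklore] -/
theorem norm_lapCoeff_sq (c : (Fin 3 → ℤ) → EuclideanSpace ℂ (Fin 3)) (k : Fin 3 → ℤ) :
    ‖-(((4 * Real.pi ^ 2 * Torus.freqNormSq k : ℝ) : ℂ) • c k)‖ ^ 2 =
      16 * Real.pi ^ 4 * Torus.freqNormSq k ^ 2 * ‖c k‖ ^ 2 := by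
  -- adapted from `Literature.Analysis.FluidPDE.NSStrongSolutions2DProofs.norm_lapMul_sq`
  rw [norm_neg, Complex.coe_smul, norm_smul, Real.norm_eq_abs,
    abs_of_nonneg (mul_nonneg (by positivity) (Torus.freqNormSq_nonneg k))]
  ring

/-- **`‖Δu‖₂²` of a real trigonometric polynomial**: `∫ ‖Δ realTrigPoly S c‖² =
16π⁴ ∑_{k∈S} |k|⁴ ‖c k‖²` (conjugate-symmetric `c`, symmetric `S`; finite Parseval). [folklore] -/
theorem integral_norm_sq_laplacian_realTrigPoly {S : Finset (Fin 3 → ℤ)}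
    (hS : ∀ k ∈ S, -k ∈ S) {c : (Fin 3 → ℤ) → EuclideanSpace ℂ (Fin 3)} (hc : Torus.IsConjSymm c) :
    ∫ x, ‖Torus.laplacian (Torus.realTrigPoly S c) x‖ ^ 2 =
      16 * Real.pi ^ 4 * ∑ k ∈ S, Torus.freqNormSq k ^ 2 * ‖c k‖ ^ 2 := by
  -- adapted from `Literature.Analysis.FluidPDE.NSStrongSolutions2DProofs.integral_norm_sq_laplacian_realTrigPoly`
  simp_rw [Torus.laplacian_realTrigPoly S c]
  rw [Torus.integral_norm_sq_realTrigPoly hS (isConjSymm_lapCoeff hc), Finset.mul_sum]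
  exact Finset.sum_congr rfl fun k _ => by rw [norm_lapCoeff_sq]; ring

/-- **Spectral `‖Δ·‖₂²` of a real trigonometric polynomial equals the classical one**:
`eLaplacianNormSq (realTrigPoly S c) = ofReal (∫ ‖Δ realTrigPoly S c‖²)`. [folklore] -/
theorem eLaplacianNormSq_realTrigPoly_eq_ofReal {S : Finset (Fin 3 → ℤ)}
    (hS : ∀ k ∈ S, -k ∈ S) {c : (Fin 3 → ℤ) → EuclideanSpace ℂ (Fin 3)} (hc : Torus.IsConjSymm c) :
    eLaplacianNormSq (Torus.realTrigPoly S c) =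
      ENNReal.ofReal (∫ x, ‖Torus.laplacian (Torus.realTrigPoly S c) x‖ ^ 2) := by
  -- adapted from `Literature.Analysis.FluidPDE.NSGalerkinEnstrophy2D.eLaplacianNormSq_realTrigPoly`
  rw [integral_norm_sq_laplacian_realTrigPoly hS hc, eLaplacianNormSq,
    Torus.eHomSobolevSeminorm_two_sq_eq_tsum']
  simp_rw [Torus.mFourierCoeff_realTrigPoly hS hc]
  rw [tsum_eq_sum (s := S) fun k hk => by simp [hk],
    ENNReal.ofReal_mul (by positivity : (0 : ℝ) ≤ 16 * Real.pi ^ 4),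
    ENNReal.ofReal_sum_of_nonneg fun k _ => mul_nonneg (sq_nonneg _) (sq_nonneg _)]
  congr 1
  refine Finset.sum_congr rfl fun k hk => ?_
  rw [if_pos hk, ENNReal.ofReal_mul (sq_nonneg _), ← ofReal_norm,
    ← ENNReal.ofReal_pow (norm_nonneg _)]
  by_cases h0 : k = 0
  · subst h0; simp [Torus.freqNormSq_zero]
  · rw [if_neg h0, Real.rpow_two]

/-- On a level-`N` field, all Fourier coefficients of `u` and `P_N u` agree. [folklore] -/
theorem mFourierCoeff_fourierTruncate_of_isLevel {N : ℕ} {u : Torus.energySpace (Fin 3)}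
    (hu : IsLevel N u) (k : Fin 3 → ℤ) :
    UnitAddTorus.mFourierCoeff (EuclideanSpace.complexify ∘ Torus.fourierTruncate N
        (u.1 : UnitAddTorus (Fin 3) → EuclideanSpace ℝ (Fin 3))) k =
      UnitAddTorus.mFourierCoeff (EuclideanSpace.complexify ∘
        (u.1 : UnitAddTorus (Fin 3) → EuclideanSpace ℝ (Fin 3))) k := by
  have hint : Integrable (u.1 : UnitAddTorus (Fin 3) → EuclideanSpace ℝ (Fin 3)) volume :=
    (Lp.memLp u.1).integrable one_le_two
  rw [Torus.mFourierCoeff_fourierTruncate hint]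
  split_ifs with hk
  · rfl
  · exact (hu k fun h => hk (Finset.mem_of_mem_erase h)).symm

/-- **Spectral `‖Δu‖₂²` of a level-`N` field is the classical `‖ΔP_N u‖₂²`**:
`eLaplacianNormSq u = ofReal (∫ ‖Δ P_N u‖²)`. [folklore] -/
theorem eLaplacianNormSq_eq_ofReal_of_isLevel {N : ℕ} {u : Torus.energySpace (Fin 3)}
    (hu : IsLevel N u) :
    eLaplacianNormSq (u.1 : UnitAddTorus (Fin 3) → EuclideanSpace ℝ (Fin 3)) =
      ENNReal.ofReal (∫ x, ‖Torus.laplacian (Torus.fourierTruncate N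
        (u.1 : UnitAddTorus (Fin 3) → EuclideanSpace ℝ (Fin 3))) x‖ ^ 2) := by
  have hint : Integrable (u.1 : UnitAddTorus (Fin 3) → EuclideanSpace ℝ (Fin 3)) volume :=
    (Lp.memLp u.1).integrable one_le_two
  have heq : eLaplacianNormSq (u.1 : UnitAddTorus (Fin 3) → EuclideanSpace ℝ (Fin 3)) =
      eLaplacianNormSq (Torus.fourierTruncate N
        (u.1 : UnitAddTorus (Fin 3) → EuclideanSpace ℝ (Fin 3))) := by
    rw [eLaplacianNormSq, eLaplacianNormSq, Torus.eHomSobolevSeminorm_two_sq_eq_tsum',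
      Torus.eHomSobolevSeminorm_two_sq_eq_tsum']
    congr 1
    exact tsum_congr fun k => by rw [mFourierCoeff_fourierTruncate_of_isLevel hu]
  rw [heq, Torus.fourierTruncate_eq]
  exact eLaplacianNormSq_realTrigPoly_eq_ofReal Torus.neg_mem_freqBall_of_mem
    (Torus.isConjSymm_mFourierCoeff hint)

/-- **Spectral `‖∇u‖₂²` of a level-`N` field is the classical `‖∇P_N u‖₂²`**:
`eGradNormSq u = ofReal (gradNormSq (P_N u))`. [folklore] -/
theorem eGradNormSq_eq_ofReal_of_isLevel {N : ℕ} {u : Torus.energySpace (Fin 3)}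
    (hu : IsLevel N u) :
    Torus.eGradNormSq (u.1 : UnitAddTorus (Fin 3) → EuclideanSpace ℝ (Fin 3)) =
      ENNReal.ofReal (Torus.gradNormSq (Torus.fourierTruncate N
        (u.1 : UnitAddTorus (Fin 3) → EuclideanSpace ℝ (Fin 3)))) := by
  rw [← CubicParityLoud.Negative.eGradNormSq_fourierTruncate_of_isLevel hu,
    Torus.eGradNormSq_eq_ofReal_gradNormSq (Torus.isSmooth_fourierTruncate _ _)]

/-- On a truncation, the spectral enstrophy in real form is the classical one:
`(eGradNormSq (P_N v)).toReal = gradNormSq (P_N v)`. [folklore] -/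
theorem toReal_eGradNormSq_fourierTruncate (N : ℕ) (v : UnitAddTorus (Fin 3) → EuclideanSpace ℝ (Fin 3)) :
    (Torus.eGradNormSq (Torus.fourierTruncate N v)).toReal = Torus.gradNormSq (Torus.fourierTruncate N v) := by
  rw [Torus.eGradNormSq_eq_ofReal_gradNormSq (Torus.isSmooth_fourierTruncate _ _),
    ENNReal.toReal_ofReal (Torus.gradNormSq_nonneg _)]

/-! ## Helpers: the pointwise weighted bound -/

/-- **The scalar heart of FMRT (B.9)–(B.11).** If `|Φ| ≤ F/ν + (ν/4)P` (force, Young),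
`|T| ≤ (ν/2)P + A Z³` (vortex stretching, FMRT (A.26b)+Young) and the row reads `G = Φ − νP + T`,
then `P/(1+Z)² ≤ (4/ν)(F/ν + A Z − G/(1+Z)²)` (`Z³/(1+Z)² ≤ Z`). [folklore] -/
theorem weighted_bound_arith {ν P Z Φ T G F A : ℝ} (hν : 0 < ν) (hZ : 0 ≤ Z) (hF : 0 ≤ F)
    (hA : 0 ≤ A) (hΦ : |Φ| ≤ F / ν + ν / 4 * P) (hT : |T| ≤ ν / 2 * P + A * Z ^ 3)
    (hG : G = Φ - ν * P + T) :
    P / (1 + Z) ^ 2 ≤ 4 / ν * (F / ν + A * Z - ((1 + Z) ^ 2)⁻¹ * G) := by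
  have h1 : ν / 4 * P ≤ F / ν + A * Z ^ 3 - G := by
    have := le_abs_self Φ
    have := le_abs_self T
    linarith
  have hw0 : 0 < (1 + Z) ^ 2 := by positivity
  have hw1 : ((1 + Z) ^ 2)⁻¹ ≤ 1 := inv_le_one_of_one_le₀ (by nlinarith)
  have hwnn : 0 ≤ ((1 + Z) ^ 2)⁻¹ := inv_nonneg.2 hw0.le
  have hZ3 : Z ^ 3 * ((1 + Z) ^ 2)⁻¹ ≤ Z := by
    rw [← div_eq_mul_inv, div_le_iff₀ hw0]
    nlinarith [sq_nonneg Z, mul_nonneg hZ (sq_nonneg Z)]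
  have h2 : ν / 4 * P * ((1 + Z) ^ 2)⁻¹ ≤ (F / ν + A * Z ^ 3 - G) * ((1 + Z) ^ 2)⁻¹ :=
    mul_le_mul_of_nonneg_right h1 hwnn
  have h3 : (F / ν + A * Z ^ 3 - G) * ((1 + Z) ^ 2)⁻¹ ≤ F / ν + A * Z - ((1 + Z) ^ 2)⁻¹ * G := by
    have hFν : 0 ≤ F / ν := div_nonneg hF hν.le
    nlinarith [mul_le_mul_of_nonneg_left hZ3 hA, mul_le_mul_of_nonneg_left hw1 hFν]
  calc P / (1 + Z) ^ 2 = 4 / ν * (ν / 4 * P * ((1 + Z) ^ 2)⁻¹) := by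
        rw [div_eq_mul_inv P]
        field_simp
    _ ≤ 4 / ν * (F / ν + A * Z - ((1 + Z) ^ 2)⁻¹ * G) :=
        mul_le_mul_of_nonneg_left (h2.trans h3) (by positivity)

/-- **Pointwise weighted palinstrophy bound** for a smooth divergence-free field `W`: if the row
value `G` satisfies the Stokes identity `G = (f, −ΔW) − ν‖ΔW‖² + ∫⟪(W·∇)W, ΔW⟫`, then
`‖ΔW‖²/(1+‖∇W‖²)² ≤ (4/ν)(‖f‖²/ν + (8K⁴/ν³)‖∇W‖² − G/(1+‖∇W‖²)²)`. [folklore] -/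
theorem weighted_bound_pointwise {ν : ℝ} (hν : 0 < ν) {K : ℝ≥0}
    (hK : ∀ u : UnitAddTorus (Fin 3) → EuclideanSpace ℝ (Fin 3), Torus.IsSmooth u → Torus.IsDivFree u →
      |∫ x, ⟪Torus.convect u u x, Torus.laplacian u x⟫_ℝ| ≤
        ν / 2 * (∫ x, ‖Torus.laplacian u x‖ ^ 2) + 8 * (K : ℝ) ^ 4 / ν ^ 3 * Torus.gradNormSq u ^ 3)
    {f W : UnitAddTorus (Fin 3) → EuclideanSpace ℝ (Fin 3)} (hf : MemLp f 2 volume)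
    (hWs : Torus.IsSmooth W) (hWd : Torus.IsDivFree W) {G : ℝ}
    (hG : G = (∫ x, ⟪f x, -(Torus.laplacian W x)⟫_ℝ) - ν * (∫ x, ‖Torus.laplacian W x‖ ^ 2) +
      ∫ x, ⟪Torus.convect W W x, Torus.laplacian W x⟫_ℝ) :
    (∫ x, ‖Torus.laplacian W x‖ ^ 2) / (1 + Torus.gradNormSq W) ^ 2 ≤
      4 / ν * ((∫ x, ‖f x‖ ^ 2) / ν + 8 * (K : ℝ) ^ 4 / ν ^ 3 * Torus.gradNormSq W -
        ((1 + Torus.gradNormSq W) ^ 2)⁻¹ * G) := by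
  have hLm : MemLp (fun x => -(Torus.laplacian W x)) 2 volume := (hWs.laplacian.memLp 2).neg
  refine weighted_bound_arith hν (Torus.gradNormSq_nonneg _) (integral_nonneg fun x => sq_nonneg _)
    (by positivity) ?_ (hK _ hWs hWd) hG
  have h := abs_integral_inner_le_young hf hLm (half_pos hν)
  simp only [norm_neg] at h
  calc _ ≤ _ := h
    _ = _ := by ring

/-! ## Helpers: the mean enstrophy of a level-`N` law in a ball -/

/-- For a law carried by level-`N` fields, `u ↦ ‖∇P_N u‖₂²` (classical) is a.e. the spectral
enstrophy `(eGradNormSq u).toReal`. [folklore] -/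
theorem gradNormSq_fourierTruncate_ae_eq {N : ℕ} {μ : Measure (Torus.energySpace (Fin 3))}
    (hlev : ∀ᵐ u ∂μ, IsLevel N u) :
    (fun u : Torus.energySpace (Fin 3) => Torus.gradNormSq (Torus.fourierTruncate N
        (u.1 : UnitAddTorus (Fin 3) → EuclideanSpace ℝ (Fin 3)))) =ᵐ[μ]
      fun u => (Torus.eGradNormSq (u.1 : UnitAddTorus (Fin 3) → EuclideanSpace ℝ (Fin 3))).toReal :=
  hlev.mono fun u hu => by
    simp only
    rw [eGradNormSq_eq_ofReal_of_isLevel hu, ENNReal.toReal_ofReal (Torus.gradNormSq_nonneg _)]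

/-- For a finite law carried by level-`N` fields and supported in a ball, the mean enstrophy is
finite and `u ↦ ‖∇P_N u‖₂²` is integrable. [folklore] -/
theorem integrable_gradNormSq_fourierTruncate {N : ℕ} {R : ℝ} {μ : Measure (Torus.energySpace (Fin 3))}
    [IsFiniteMeasure μ] (hlev : ∀ᵐ u ∂μ, IsLevel N u) (hsupp : IsSupported R μ) :
    Integrable (fun u : Torus.energySpace (Fin 3) => Torus.gradNormSq (Torus.fourierTruncate N
        (u.1 : UnitAddTorus (Fin 3) → EuclideanSpace ℝ (Fin 3)))) μ := by
  have h2 := integrable_norm_pow_of_isSupported hsupp 2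
  have h2E : ∫⁻ u, ‖u‖ₑ ^ 2 ∂μ = ENNReal.ofReal (Torus.ensembleEnergy μ) := by
    rw [Torus.ensembleEnergy, ofReal_integral_eq_lintegral_ofReal h2
      (ae_of_all _ fun u => by positivity)]
    refine lintegral_congr fun u => ?_
    rw [← ofReal_norm, ← ENNReal.ofReal_pow (norm_nonneg _)]
  have hfin : Torus.ensembleEnstrophy μ < ⊤ := by
    refine (ensembleEnstrophy_le_of_level (hlev.mono fun u hu => hu)).trans_lt ?_
    rw [h2E]
    exact ENNReal.mul_lt_top ENNReal.ofReal_lt_top ENNReal.ofReal_lt_top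
  exact (integrable_toReal_of_lintegral_ne_top Torus.measurable_eGradNormSq_coe.aemeasurable
    hfin.ne).congr (gradNormSq_fourierTruncate_ae_eq hlev).symm

/-- **Mean enstrophy bound from the energy row**: for a probability law carried by level-`N`
fields, supported in the ball of radius `R` and polynomially stationary,
`∫ ‖∇P_N u‖₂² dμ ≤ ‖f‖₂ max(R,0) / ν` (`ν ∫ Z dμ = ∫ (u,f) dμ ≤ ‖f‖₂ R`). [folklore] -/
theorem integral_gradNormSq_fourierTruncate_le {ν : ℝ} (hν : 0 < ν)
    {f : UnitAddTorus (Fin 3) → EuclideanSpace ℝ (Fin 3)} (hf : MemLp f 2 volume) {N : ℕ} {R : ℝ}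
    {μ : Measure (Torus.energySpace (Fin 3))} [IsProbabilityMeasure μ]
    (hlev : ∀ᵐ u ∂μ, IsLevel N u) (hsupp : IsSupported R μ) (hstat : ∀ d, IsPolyStationary ν f N d μ) :
    ∫ u, Torus.gradNormSq (Torus.fourierTruncate N
        (u.1 : UnitAddTorus (Fin 3) → EuclideanSpace ℝ (Fin 3))) ∂μ ≤
      Real.sqrt (∫ x, ‖f x‖ ^ 2) * max R 0 / ν := by
  have h2 := integrable_norm_pow_of_isSupported hsupp 2
  have hrow := ensembleDissipation_eq_of_polyStationary f hf hlev h2 (le_refl 3) (hstat 3)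
  have hZ : ∫ u, Torus.gradNormSq (Torus.fourierTruncate N
      (u.1 : UnitAddTorus (Fin 3) → EuclideanSpace ℝ (Fin 3))) ∂μ = (Torus.ensembleEnstrophy μ).toReal := by
    rw [integral_congr_ae (gradNormSq_fourierTruncate_ae_eq hlev), Torus.ensembleEnstrophy,
      integral_toReal Torus.measurable_eGradNormSq_coe.aemeasurable
        (hlev.mono fun u hu => CubicParityLoud.Negative.eGradNormSq_lt_top_of_isLevel hu)]
  have hpair : ∫ u, Torus.pairing u.1 f ∂μ ≤ max R 0 * ‖hf.toLp f‖ := by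
    have hp := integral_mono_ae (CubicParityLoud.Negative.integrable_pairing hf (integrable_norm_of_norm_sq h2))
      (integrable_const (max R 0 * ‖hf.toLp f‖))
      (Filter.Eventually.mono hsupp fun u (hu : ‖u‖ ≤ R) => (le_abs_self _).trans
        ((Torus.abs_pairing_coe_le hf u).trans
          (mul_le_mul_of_nonneg_right (hu.trans (le_max_left _ _)) (norm_nonneg _))))
    rwa [integral_const, smul_eq_mul, probReal_univ, one_mul] at hp
  have hdiss : Torus.ensembleDissipation ν μ ≤ max R 0 * ‖hf.toLp f‖ := hrow.trans_le hpair
  unfold Torus.ensembleDissipation at hdiss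
  rw [le_div_iff₀ hν, hZ, mul_comm]
  calc ν * (Torus.ensembleEnstrophy μ).toReal ≤ max R 0 * ‖hf.toLp f‖ := hdiss
    _ = Real.sqrt (∫ x, ‖f x‖ ^ 2) * max R 0 := by
        rw [CubicParityLoud.Negative.norm_toLp_eq_sqrt hf, mul_comm]

/-! ## Helpers: the integration step -/

/-- **Integration of the weighted row.** On a probability space: if `Φ = ofReal (P/(1+Z)²)` and
`P/(1+Z)² ≤ c (F + A Z − G/(1+Z)²)` a.e., with `P, Z ≥ 0`, `Z` and `G` integrable and
`∫ G/(1+Z)² dμ = 0`, then `∫⁻ Φ dμ ≤ ofReal (c (F + A ∫ Z dμ))`. [folklore] -/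
theorem lintegral_le_of_weighted_row {μ : Measure (Torus.energySpace (Fin 3))} [IsProbabilityMeasure μ]
    {Φ : Torus.energySpace (Fin 3) → ℝ≥0∞} {P Z G : Torus.energySpace (Fin 3) → ℝ} {c F A : ℝ}
    (hconv : ∀ᵐ u ∂μ, Φ u = ENNReal.ofReal (P u / (1 + Z u) ^ 2))
    (hpt : ∀ᵐ u ∂μ, P u / (1 + Z u) ^ 2 ≤ c * (F + A * Z u - ((1 + Z u) ^ 2)⁻¹ * G u))
    (hP : ∀ u, 0 ≤ P u) (hZ : ∀ u, 0 ≤ Z u) (hZint : Integrable Z μ) (hGint : Integrable G μ)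
    (hG0 : ∫ u, ((1 + Z u) ^ 2)⁻¹ * G u ∂μ = 0) :
    ∫⁻ u, Φ u ∂μ ≤ ENNReal.ofReal (c * (F + A * ∫ u, Z u ∂μ)) := by
  -- the weighted row is integrable (`|w| ≤ 1`, `w` a.e.-measurable)
  have hwG : Integrable (fun u => ((1 + Z u) ^ 2)⁻¹ * G u) μ := by
    refine hGint.bdd_mul (c := 1) ?_ (ae_of_all _ fun u => ?_)
    · exact ((hZint.aestronglyMeasurable.aemeasurable.const_add 1).pow_const 2).inv.aestronglyMeasurable
    · rw [Real.norm_eq_abs, abs_of_nonneg (inv_nonneg.2 (sq_nonneg _))]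
      exact inv_le_one_of_one_le₀ (by nlinarith [hZ u])
  have h12 : Integrable (fun u => F + A * Z u) μ := (integrable_const _).add (hZint.const_mul _)
  have hRint : Integrable (fun u => c * (F + A * Z u - ((1 + Z u) ^ 2)⁻¹ * G u)) μ :=
    (h12.sub hwG).const_mul _
  have hRval : ∫ u, c * (F + A * Z u - ((1 + Z u) ^ 2)⁻¹ * G u) ∂μ = c * (F + A * ∫ u, Z u ∂μ) := by
    rw [integral_const_mul, integral_sub h12 hwG, integral_add (integrable_const _) (hZint.const_mul _),
      integral_const_mul, integral_const, hG0]
    simp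
  have hRnn : 0 ≤ᵐ[μ] fun u => c * (F + A * Z u - ((1 + Z u) ^ 2)⁻¹ * G u) :=
    hpt.mono fun u hu => (div_nonneg (hP u) (sq_nonneg _)).trans hu
  calc ∫⁻ u, Φ u ∂μ = ∫⁻ u, ENNReal.ofReal (P u / (1 + Z u) ^ 2) ∂μ := lintegral_congr_ae hconv
    _ ≤ ∫⁻ u, ENNReal.ofReal (c * (F + A * Z u - ((1 + Z u) ^ 2)⁻¹ * G u)) ∂μ :=
        lintegral_mono_ae (hpt.mono fun u hu => ENNReal.ofReal_le_ofReal hu)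
    _ = ENNReal.ofReal (∫ u, c * (F + A * Z u - ((1 + Z u) ^ 2)⁻¹ * G u) ∂μ) :=
        (ofReal_integral_eq_lintegral_ofReal hRint hRnn).symm
    _ = ENNReal.ofReal (c * (F + A * ∫ u, Z u ∂μ)) := by rw [hRval]

/-! ## The stub: the N-uniform weighted palinstrophy bound -/

/-- **A2d — the N-uniform WEIGHTED PALINSTROPHY BOUND** (FMRT 2001 Ch. II App. B (B.9)–(B.11) at
Galerkin level). From the Stokes-weighted truncation row (A2b) and the weight-stationarity (A2c):
for `f` smooth, `ν > 0` and a radius `R` there is `C < ∞` such that every probability law on `H`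
carried by level-`N` fields, supported in `‖u‖ ≤ R` and polynomially stationary at every degree,
has `∫ ‖Δu‖²/(1+‖∇u‖²)² dμ ≤ C` — uniformly in the level `N`. Explicitly
`C = (4/ν)(‖f‖₂²/ν + (8K⁴/ν³) ‖f‖₂ max(R,0)/ν)` with the vortex-stretching constant `K` of
`Torus.abs_integral_inner_convect_laplacian_le_dissipation`. [folklore] -/
theorem stub_weightedPalinstrophyBound :
    (∀ (ν : ℝ) (f : UnitAddTorus (Fin 3) → EuclideanSpace ℝ (Fin 3)) (N : ℕ) (u : Torus.energySpace (Fin 3)),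
      IsLevel N u →
      Torus.nsGeneratorPairing ν f u (fun x => -(Torus.laplacian (Torus.fourierTruncate N
          (u.1 : UnitAddTorus (Fin 3) → EuclideanSpace ℝ (Fin 3))) x)) =
        (∫ x, ⟪f x, -(Torus.laplacian (Torus.fourierTruncate N
            (u.1 : UnitAddTorus (Fin 3) → EuclideanSpace ℝ (Fin 3))) x)⟫_ℝ) -
          ν * (∫ x, ‖Torus.laplacian (Torus.fourierTruncate N
            (u.1 : UnitAddTorus (Fin 3) → EuclideanSpace ℝ (Fin 3))) x‖ ^ 2) +
          ∫ x, ⟪Torus.convect (Torus.fourierTruncate N (u.1 : UnitAddTorus (Fin 3) → EuclideanSpace ℝ (Fin 3)))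
              (Torus.fourierTruncate N (u.1 : UnitAddTorus (Fin 3) → EuclideanSpace ℝ (Fin 3))) x,
            Torus.laplacian (Torus.fourierTruncate N
              (u.1 : UnitAddTorus (Fin 3) → EuclideanSpace ℝ (Fin 3))) x⟫_ℝ) →
    (∀ (ν : ℝ) (f : UnitAddTorus (Fin 3) → EuclideanSpace ℝ (Fin 3)) (N : ℕ) (R : ℝ)
      (μ : Measure (Torus.energySpace (Fin 3))) [IsFiniteMeasure μ],
      IsSupported R μ → (∀ d, IsPolyStationary ν f N d μ) →
      Integrable (fun u : Torus.energySpace (Fin 3) => Torus.nsGeneratorPairing ν f u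
          (fun x => -(Torus.laplacian (Torus.fourierTruncate N
            (u.1 : UnitAddTorus (Fin 3) → EuclideanSpace ℝ (Fin 3))) x))) μ ∧
      ∫ u, ((1 + (Torus.eGradNormSq (Torus.fourierTruncate N
            (u.1 : UnitAddTorus (Fin 3) → EuclideanSpace ℝ (Fin 3)))).toReal) ^ 2)⁻¹ *
          Torus.nsGeneratorPairing ν f u (fun x => -(Torus.laplacian (Torus.fourierTruncate N
            (u.1 : UnitAddTorus (Fin 3) → EuclideanSpace ℝ (Fin 3))) x)) ∂μ = 0) →
    ∀ (f : UnitAddTorus (Fin 3) → EuclideanSpace ℝ (Fin 3)), Torus.IsSmooth f → ∀ (ν : ℝ), 0 < ν → ∀ (R : ℝ),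
      ∃ C : ℝ≥0∞, C < ⊤ ∧ ∀ (N : ℕ) (μ : Measure (Torus.energySpace (Fin 3))), IsProbabilityMeasure μ →
        (∀ᵐ u ∂μ, IsLevel N u) → IsSupported R μ → (∀ d, IsPolyStationary ν f N d μ) →
        ∫⁻ u, eLaplacianNormSq (u.1 : UnitAddTorus (Fin 3) → EuclideanSpace ℝ (Fin 3)) /
            (1 + Torus.eGradNormSq (u.1 : UnitAddTorus (Fin 3) → EuclideanSpace ℝ (Fin 3))) ^ 2 ∂μ ≤ C := by
  intro hB hC f hfs ν hν R
  -- the vortex-stretching constant (FMRT (A.26b) + Young), independent of `N` and `μ`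
  obtain ⟨K, hK⟩ := Torus.abs_integral_inner_convect_laplacian_le_dissipation (d := Fin 3) (by simp)
  have hf2 : MemLp f 2 volume := hfs.memLp 2
  refine ⟨ENNReal.ofReal (4 / ν * ((∫ x, ‖f x‖ ^ 2) / ν +
      8 * (K : ℝ) ^ 4 / ν ^ 3 * (Real.sqrt (∫ x, ‖f x‖ ^ 2) * max R 0 / ν))),
    ENNReal.ofReal_lt_top, fun N μ hP hlev hsupp hstat => ?_⟩
  haveI := hP
  -- the row `G u = ⟨F(u), -ΔP_N u⟩`: integrable, with vanishing weighted mean (A2c)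
  obtain ⟨hGint, hG0⟩ := hC ν f N R μ hsupp hstat
  simp only [toReal_eGradNormSq_fourierTruncate] at hG0
  -- the enstrophy `Z u = ‖∇P_N u‖²`: integrable, with mean `≤ ‖f‖₂ R₊ / ν` (energy row)
  have hZint := integrable_gradNormSq_fourierTruncate hlev hsupp
  have hZle := integral_gradNormSq_fourierTruncate_le hν hf2 hlev hsupp hstat
  have hA0 : 0 ≤ 8 * (K : ℝ) ^ 4 / ν ^ 3 := by positivity
  calc _ ≤ ENNReal.ofReal (4 / ν * ((∫ x, ‖f x‖ ^ 2) / ν +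
          8 * (K : ℝ) ^ 4 / ν ^ 3 * ∫ u, Torus.gradNormSq (Torus.fourierTruncate N
            (u.1 : UnitAddTorus (Fin 3) → EuclideanSpace ℝ (Fin 3))) ∂μ)) :=
        lintegral_le_of_weighted_row
          (P := fun u => ∫ x, ‖Torus.laplacian (Torus.fourierTruncate N
              (u.1 : UnitAddTorus (Fin 3) → EuclideanSpace ℝ (Fin 3))) x‖ ^ 2)
          (Z := fun u => Torus.gradNormSq (Torus.fourierTruncate N
              (u.1 : UnitAddTorus (Fin 3) → EuclideanSpace ℝ (Fin 3))))
          (G := fun u => Torus.nsGeneratorPairing ν f u (fun x => -(Torus.laplacian (Torus.fourierTruncate N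
              (u.1 : UnitAddTorus (Fin 3) → EuclideanSpace ℝ (Fin 3))) x)))
          ?_ ?_ (fun u => integral_nonneg fun x => sq_nonneg _) (fun u => Torus.gradNormSq_nonneg _)
          hZint hGint hG0
    _ ≤ _ := ENNReal.ofReal_le_ofReal (by gcongr)
  · -- the integrand of the goal, a.e., in real form (level-`N`: spectral = classical on `P_N u`)
    refine hlev.mono fun u hu => ?_
    beta_reduce
    have hZ0 := Torus.gradNormSq_nonneg (Torus.fourierTruncate N
              (u.1 : UnitAddTorus (Fin 3) → EuclideanSpace ℝ (Fin 3)))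
    rw [eLaplacianNormSq_eq_ofReal_of_isLevel hu, eGradNormSq_eq_ofReal_of_isLevel hu,
      ← ENNReal.ofReal_one, ← ENNReal.ofReal_add zero_le_one hZ0,
      ← ENNReal.ofReal_pow (add_nonneg zero_le_one hZ0),
      ENNReal.ofReal_div_of_pos (pow_pos (add_pos_of_pos_of_nonneg one_pos hZ0) 2)]
  · -- the pointwise bound, a.e. (A2b + FMRT (A.26b) + Young)
    exact hlev.mono fun u hu => weighted_bound_pointwise hν (hK ν hν) hf2
      (Torus.isSmooth_fourierTruncate _ _)
      (Torus.isDivFree_fourierTruncate (Lp.memLp u.1) (Torus.isWeaklyDivFree_of_mem_energySpace u.2) N)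
      (hB ν f N u hu)

end Summit.AnomalousDissipation.AnomalousDissipation.Theorems.MomentLadder

end
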